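import Mathlib.Algebra.Homology.DerivedCategory.ShortExact
import Mathlib.CategoryTheory.Triangulated.Pretriangulated
import Mathlib.CategoryTheory.Shift.Localization
import Mathlib.Algebra.Homology.DerivedCategory.ExactFunctor
import HarnessLib

/-!
# Descent of a quasi-isomorphism-preserving endofunctor of cochain complexes to the derived category

Cell `pub-hsemireg` (run/shared/lean/pub/pub-hsemireg/), Lean side (p3); K2-MIN piece (g) of the cell's blueprint
(general-structure/G4-SUMMARY.md, gs-g4 gen 14). HONEST FRAMING: generic Mathlib plumbing over an arbitrary abelian
category with a derived category; NOT a door, NOT a fact, NOT a «K2 result», nothing about any variety. Intended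
instance: the internal Hom complex `𝓗om•(E•, –)` of a strictly perfect `E•` (`HomComplex.lean`, t-7), which preserves
quasi-isomorphisms; the descended functor is the «`Φ_E`» through which a trace on `Ext` of complexes is applied.

## Contents (everything proved; Mathlib only)

For `C` abelian with `HasDerivedCategory C` and `Φ : CochainComplex C ℤ ⥤ CochainComplex C ℤ`:

* `isInvertedBy_of_map_quasiIso` — if `Φ` sends quasi-isomorphisms to quasi-isomorphisms, `Φ ⋙ Q` inverts them;
* **`quasiIso_map_of_shortExact`** (two-out-of-three): for a sequence `0 → Φ₁ → Φ₂ → Φ₃ → 0` of endofunctors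
  which is short exact at every complex, if `Φ₁` and `Φ₃` preserve quasi-isomorphisms then so does `Φ₂` — a
  morphism of the two distinguished triangles (`DerivedCategory.triangleOfSES.map`) with isomorphisms at the ends
  is an isomorphism (`Pretriangulated.isIso₂_of_isIso₁₃`), and `Q f` is an isomorphism iff `f` is a
  quasi-isomorphism (the induction step of «`𝓗om•(E•, –)` preserves quasi-isomorphisms» over brutal truncations);
* `derivedLift hΦ : DerivedCategory C ⥤ DerivedCategory C` (Mathlib `Localization.lift` along `Q`), the
  factorisation `derivedLiftFac : Q ⋙ derivedLift ≅ Φ ⋙ Q` (`Localization.Lifting`), its `CommShift ℤ` structure when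
  `Φ` commutes with shifts (`Functor.commShiftOfLocalization`), and the induced action on shifted Homs of complexes
  `shiftedHomMap : (Q K ⟶ (Q L)⟦n⟧) → (Q (Φ K) ⟶ (Q (Φ L))⟦n⟧)`; and `derivedLiftIsoMapDerivedCategory`: if
  `Φ ≅ G.mapHomologicalComplex` for an exact `G`, then `derivedLift Φ ≅ G.mapDerivedCategory` (`Localization.liftNatIso`).

## References

* Mathlib: `CategoryTheory.Localization` (lift/Lifting), `Functor.commShiftOfLocalization`, `DerivedCategory.triangleOfSES`,
  `Pretriangulated.isIso₂_of_isIso₁₃` (all statements here are folklore consequences of these).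
-/

noncomputable section

open CategoryTheory CategoryTheory.Limits

universe w v u

namespace Summit.Ventures.HSemireg

variable {C : Type u} [Category.{v} C] [Abelian C] [HasDerivedCategory.{w} C]
  (Φ : CochainComplex C ℤ ⥤ CochainComplex C ℤ)

variable {Φ} in
/-- A quasi-isomorphism-preserving `Φ` followed by `Q` inverts quasi-isomorphisms. [folklore] -/
lemma isInvertedBy_of_map_quasiIso
    (hΦ : ∀ ⦃K L : CochainComplex C ℤ⦄ (f : K ⟶ L), QuasiIso f → QuasiIso (Φ.map f)) :
    (HomologicalComplex.quasiIso C (ComplexShape.up ℤ)).IsInvertedBy (Φ ⋙ DerivedCategory.Q) := by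
  intro K L f hf
  have : QuasiIso (Φ.map f) := hΦ f ((HomologicalComplex.mem_quasiIso_iff f).mp hf)
  change IsIso (DerivedCategory.Q.map (Φ.map f))
  infer_instance

/-- **Two-out-of-three for quasi-isomorphism preservation**: if `0 → Φ₁ → Φ₂ → Φ₃ → 0` is a sequence of
endofunctors of cochain complexes which is short exact at every complex, and `Φ₁`, `Φ₃` send quasi-isomorphisms to
quasi-isomorphisms, so does `Φ₂` (morphism of distinguished triangles with isomorphisms at the ends).
[folklore] -/
theorem quasiIso_map_of_shortExact {Φ₁ Φ₂ Φ₃ : CochainComplex C ℤ ⥤ CochainComplex C ℤ}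
    (ι : Φ₁ ⟶ Φ₂) (π : Φ₂ ⟶ Φ₃) (w : ∀ L, ι.app L ≫ π.app L = 0)
    (hS : ∀ L, (ShortComplex.mk (ι.app L) (π.app L) (w L)).ShortExact)
    (h₁ : ∀ ⦃K L : CochainComplex C ℤ⦄ (f : K ⟶ L), QuasiIso f → QuasiIso (Φ₁.map f))
    (h₃ : ∀ ⦃K L : CochainComplex C ℤ⦄ (f : K ⟶ L), QuasiIso f → QuasiIso (Φ₃.map f))
    {K L : CochainComplex C ℤ} (f : K ⟶ L) (hf : QuasiIso f) : QuasiIso (Φ₂.map f) := by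
  rw [← DerivedCategory.isIso_Q_map_iff_quasiIso]
  have h₁' : IsIso (DerivedCategory.Q.map (Φ₁.map f)) :=
    (DerivedCategory.isIso_Q_map_iff_quasiIso (φ := Φ₁.map f)).mpr (h₁ f hf)
  have h₃' : IsIso (DerivedCategory.Q.map (Φ₃.map f)) :=
    (DerivedCategory.isIso_Q_map_iff_quasiIso (φ := Φ₃.map f)).mpr (h₃ f hf)
  let φ : ShortComplex.mk (ι.app K) (π.app K) (w K) ⟶ ShortComplex.mk (ι.app L) (π.app L) (w L) :=
    { τ₁ := Φ₁.map f
      τ₂ := Φ₂.map f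
      τ₃ := Φ₃.map f
      comm₁₂ := ι.naturality f
      comm₂₃ := π.naturality f }
  exact Pretriangulated.isIso₂_of_isIso₁₃ (DerivedCategory.triangleOfSES.map (hS K) (hS L) φ)
    (DerivedCategory.triangleOfSES_distinguished (hS K)) (DerivedCategory.triangleOfSES_distinguished (hS L))
    h₁' h₃'

variable (hΦ : (HomologicalComplex.quasiIso C (ComplexShape.up ℤ)).IsInvertedBy (Φ ⋙ DerivedCategory.Q))

/-- **Descent to the derived category**: the functor `D(C) ⥤ D(C)` induced by an endofunctor of cochain complexes
which (followed by `Q`) inverts quasi-isomorphisms — Mathlib `Localization.lift` along `Q`. [folklore] -/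
def derivedLift : DerivedCategory C ⥤ DerivedCategory C :=
  Localization.lift (Φ ⋙ DerivedCategory.Q) hΦ DerivedCategory.Q

/-- The defining factorisation `Q ⋙ derivedLift Φ ≅ Φ ⋙ Q` (as a `Lifting` instance). [folklore] -/
instance derivedLift_lifting :
    Localization.Lifting DerivedCategory.Q (HomologicalComplex.quasiIso C (ComplexShape.up ℤ))
      (Φ ⋙ DerivedCategory.Q) (derivedLift Φ hΦ) := by
  unfold derivedLift; infer_instance

/-- The defining factorisation `Q ⋙ derivedLift Φ ≅ Φ ⋙ Q` as an isomorphism. [folklore] -/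
def derivedLiftFac : DerivedCategory.Q ⋙ derivedLift Φ hΦ ≅ Φ ⋙ DerivedCategory.Q :=
  Localization.Lifting.iso DerivedCategory.Q (HomologicalComplex.quasiIso C (ComplexShape.up ℤ))
    (Φ ⋙ DerivedCategory.Q) (derivedLift Φ hΦ)

/-- **The descended functor commutes with shifts** when `Φ` does (Mathlib `Functor.commShiftOfLocalization`, from
the `CommShift` of `Φ ⋙ Q`). [folklore] -/
instance derivedLift_commShift [Φ.CommShift ℤ] : (derivedLift Φ hΦ).CommShift ℤ :=
  Functor.commShiftOfLocalization DerivedCategory.Q (HomologicalComplex.quasiIso C (ComplexShape.up ℤ)) ℤ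
    (Φ ⋙ DerivedCategory.Q) (derivedLift Φ hΦ)

/-- **Action on shifted Homs of complexes**: `x : Q K ⟶ (Q L)⟦n⟧ ↦ Φ_*(x) : Q (Φ K) ⟶ (Q (Φ L))⟦n⟧` (apply
`derivedLift Φ`, then conjugate by the factorisation isomorphism). [folklore] -/
def shiftedHomMap [Φ.CommShift ℤ] {K L : CochainComplex C ℤ} {n : ℤ}
    (x : ShiftedHom (DerivedCategory.Q.obj K) (DerivedCategory.Q.obj L) n) :
    ShiftedHom (DerivedCategory.Q.obj (Φ.obj K)) (DerivedCategory.Q.obj (Φ.obj L)) n :=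
  (derivedLiftFac Φ hΦ).inv.app K ≫ x.map (derivedLift Φ hΦ) ≫ ((derivedLiftFac Φ hΦ).hom.app L)⟦n⟧'


/-- **Comparison with Mathlib's derived functor of an exact functor**: if `Φ` is (naturally isomorphic to) the
prolongation `G.mapHomologicalComplex` of an exact functor `G : C ⥤ C`, the descended functor `derivedLift Φ` is
Mathlib's `G.mapDerivedCategory` (uniqueness of localization lifts, `Localization.liftNatIso`). Intended use: the column
case `𝓗om•(E₀[0], –) ≅ 𝓗om(E₀, –)` termwise (`HomComplex.columnIso`), comparing the complex-level trace pipeline with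
the module one. [folklore] -/
def derivedLiftIsoMapDerivedCategory (G : C ⥤ C) [G.Additive] [PreservesFiniteLimits G] [PreservesFiniteColimits G]
    (e : Φ ≅ G.mapHomologicalComplex (ComplexShape.up ℤ)) : derivedLift Φ hΦ ≅ G.mapDerivedCategory :=
  Localization.liftNatIso DerivedCategory.Q (HomologicalComplex.quasiIso C (ComplexShape.up ℤ))
    (Φ ⋙ DerivedCategory.Q) (G.mapHomologicalComplex (ComplexShape.up ℤ) ⋙ DerivedCategory.Q)
    (derivedLift Φ hΦ) G.mapDerivedCategory (Functor.isoWhiskerRight e DerivedCategory.Q)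

end Summit.Ventures.HSemireg

end
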